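import Mathlib.LinearAlgebra.Matrix.Hermitian
import Mathlib.LinearAlgebra.Matrix.Notation
import Mathlib.Analysis.Normed.Algebra.MatrixExponential
import Mathlib.LinearAlgebra.UnitaryGroup
import Mathlib.Analysis.SpecialFunctions.Pow.Real
import Mathlib.Analysis.Complex.Basic
import Mathlib.Algebra.Lie.OfAssociative
import HarnessLib

-- provenance: harness21/H21/H21/Prelude/QLatticeAQFT/SpinOperators.lean @ e53059b (interim HEAD d8f2665); M5 mechanical rewrite
/-!
# Spin operators (trunk QLatticeAQFT, item Q2)

The spin-`S` representation of `𝔰𝔲(2)` by `(2S+1) × (2S+1)` complex matrices, the basic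
single-site ingredient of quantum spin systems (Heisenberg, AKLT, Lieb–Mattis, LSM, ...).

We index by `n : ℕ` with `n = 2S`, so the local Hilbert space is `ℂ^{n+1}` with basis
`k : Fin (n+1)` corresponding to the magnetic quantum number `m = n/2 - k`
(so `k = 0` is the highest-weight vector `m = S`). In this basis

* `spinZ n = diag(n/2, n/2 - 1, …, -n/2)`;
* `spinRaise n` (`S⁺`) has the entries `⟨k| S⁺ |k+1⟩ = √((k+1)(n-k))`
  (i.e. `S⁺|S,m⟩ = √(S(S+1) - m(m+1)) |S,m+1⟩`), `spinLower n = (spinRaise n)ᴴ`;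
* `spinX = (S⁺ + S⁻)/2`, `spinY = (S⁺ - S⁻)/(2i)`;
* `spinVec n : Fin 3 → Matrix _ _ ℂ` packages `(Sˣ, Sʸ, Sᶻ)` as indices `0, 1, 2`;
* `spinCasimir n = Σ_α (S^α)²`;
* `spinHalfPauli : Fin 3 → Matrix (Fin 2) (Fin 2) ℂ`, the explicit Pauli matrices `σˣ, σʸ, σᶻ`;
* `spinRotation n θ = exp(-i Σ_α θ_α S^α)`.

API: `spinVec_isHermitian`, `spinZ_apply`, `spinRaise_apply`, `spin_commutation`
(`[Sᵃ, Sᵇ] = i ε_{abc} Sᶜ`, stated cyclically), `spinCasimir_eq` (`𝐒² = S(S+1)𝟙`),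
`spinVec_one_eq_half_spinHalfPauli` (`S = σ/2` for spin `1/2`), `spinRotation_mem_unitaryGroup`.

## Sources

H. Tasaki, *Physics and Mathematics of Quantum Many-Body Systems* (Springer, 2020), §2.1,
eqs. (2.1.1)–(2.1.10); problem 2.1.a for the explicit matrices.

## Mathlib / H21 status and design choices

* Mathlib (grep for `pauli`, `spin`, `LeviCivita`) has no Pauli or spin matrices and no Levi-Civita
  symbol; commutators of matrices are Mathlib's ring commutator `⁅A, B⁆ = A * B - B * A`
  (`Ring.lie_def`, `Mathlib.Algebra.Lie.OfAssociative`), matrix exponentials are `NormedSpace.exp`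
  (`Mathlib.Analysis.Normed.Algebra.MatrixExponential`), unitarity is `Matrix.unitaryGroup`.
* The Pauli matrices are named `spinHalfPauli` and NOT `pauliX/Y/Z`: the accepted
  `Literature.Computability.Cryptography.pauliX` / `Literature.Computability.Cryptography.pauliZ`
  (`H21/Prelude/CryptoQuantFine/QubitRegister.lean`) are gates on the qubit register
  `QReg 1 = Fin 1 → Fin 2`, a different index type; we neither import nor duplicate them.
* The commutation relations are stated in the cyclic form `⁅S a, S (a+1)⁆ = i • S (a+2)` for
  `a : Fin 3` (addition mod `3`), which is equivalent to `[Sᵃ, Sᵇ] = i ε_{abc} Sᶜ` and avoids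
  introducing a Levi-Civita symbol.
* Entries are written with real square roots cast into `ℂ`; `n/2 - k` is computed in `ℂ`
  (no natural-number subtraction).
-/

noncomputable section

open Matrix Complex

namespace Literature.MathematicalPhysics.QuantumLattice

section QLattice

variable (n : ℕ)

/-- The spin-`z` operator `Sᶻ` of spin `S = n/2` on `ℂ^{n+1}`: the diagonal matrix with entries
`m = n/2 - k`, `k : Fin (n+1)` (so `Sᶻ = diag(S, S-1, …, -S)`). Tasaki (2020) §2.1, eq. (2.1.5). [cite: Tasaki2020] -/
def SpinOperators.spinZ : Matrix (Fin (n + 1)) (Fin (n + 1)) ℂ :=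
  diagonal fun k => (n : ℂ) / 2 - (k : ℂ)

/-- The spin raising operator `S⁺ = Sˣ + i Sʸ` of spin `S = n/2`: the only nonzero entries are
`⟨k| S⁺ |k+1⟩ = √((k+1)(n-k))`, i.e. `S⁺|S, m⟩ = √(S(S+1) - m(m+1)) |S, m+1⟩` with `m = n/2 - (k+1)`.
Tasaki (2020) §2.1, eq. (2.1.6). [cite: Tasaki2020] -/
def spinRaise : Matrix (Fin (n + 1)) (Fin (n + 1)) ℂ :=
  of fun k l => if l.val = k.val + 1 then (Real.sqrt ((k.val + 1 : ℝ) * (n - k.val : ℝ)) : ℂ) else 0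

/-- The spin lowering operator `S⁻ = Sˣ - i Sʸ = (S⁺)†`. Tasaki (2020) §2.1, eq. (2.1.6). [cite: Tasaki2020] -/
def spinLower : Matrix (Fin (n + 1)) (Fin (n + 1)) ℂ :=
  (spinRaise n)ᴴ

/-- The spin-`x` operator `Sˣ = (S⁺ + S⁻)/2` of spin `S = n/2`. Tasaki (2020) §2.1, eq. (2.1.6). [cite: Tasaki2020] -/
def spinX : Matrix (Fin (n + 1)) (Fin (n + 1)) ℂ :=
  (1 / 2 : ℂ) • (spinRaise n + spinLower n)

/-- The spin-`y` operator `Sʸ = (S⁺ - S⁻)/(2i)` of spin `S = n/2`. Tasaki (2020) §2.1, eq. (2.1.6). [cite: Tasaki2020] -/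
def spinY : Matrix (Fin (n + 1)) (Fin (n + 1)) ℂ :=
  (1 / (2 * I) : ℂ) • (spinRaise n - spinLower n)

/-- The spin vector `𝐒 = (Sˣ, Sʸ, Sᶻ)` of spin `S = n/2`, indexed by `Fin 3` (`0 ↦ Sˣ`, `1 ↦ Sʸ`,
`2 ↦ Sᶻ`). Tasaki (2020) §2.1, eqs. (2.1.1), (2.1.5)–(2.1.6). [cite: Tasaki2020] -/
def spinVec : Fin 3 → Matrix (Fin (n + 1)) (Fin (n + 1)) ℂ :=
  ![spinX n, spinY n, SpinOperators.spinZ n]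

/-- Component `0` of the spin vector is `Sˣ`. Tasaki (2020) §2.1. [cite: Tasaki2020] -/
@[simp] lemma spinVec_zero : spinVec n 0 = spinX n := rfl

/-- Component `1` of the spin vector is `Sʸ`. Tasaki (2020) §2.1. [cite: Tasaki2020] -/
@[simp] lemma spinVec_one : spinVec n 1 = spinY n := rfl

/-- Component `2` of the spin vector is `Sᶻ`. Tasaki (2020) §2.1. [cite: Tasaki2020] -/
@[simp] lemma spinVec_two : spinVec n 2 = SpinOperators.spinZ n := rfl

/-- The Casimir operator `𝐒² = (Sˣ)² + (Sʸ)² + (Sᶻ)²` of spin `S = n/2`.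
Tasaki (2020) §2.1, eq. (2.1.2). [cite: Tasaki2020] -/
def spinCasimir : Matrix (Fin (n + 1)) (Fin (n + 1)) ℂ :=
  ∑ α : Fin 3, spinVec n α * spinVec n α

/-- The Pauli matrices `σˣ = !![0, 1; 1, 0]`, `σʸ = !![0, -i; i, 0]`, `σᶻ = !![1, 0; 0, -1]`,
indexed by `Fin 3`. Not named `pauliX/Y/Z`: the qubit gates `Literature.Computability.Cryptography.pauliX`,
`Literature.Computability.Cryptography.pauliZ` (`H21/Prelude/CryptoQuantFine/QubitRegister.lean`) act on
`QReg 1 = Fin 1 → Fin 2`, a different index type. Tasaki (2020) §2.1, eq. (2.1.8). [cite: Tasaki2020] -/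
def spinHalfPauli : Fin 3 → Matrix (Fin 2) (Fin 2) ℂ :=
  ![!![0, 1; 1, 0], !![0, -I; I, 0], !![1, 0; 0, -1]]

/-- The spin rotation operator `U(θ) = exp(-i Σ_α θ_α S^α)` of spin `S = n/2`, for a rotation
vector `θ : Fin 3 → ℝ`. Tasaki (2020) §2.1, eq. (2.1.10). [cite: Tasaki2020] -/
def spinRotation (θ : Fin 3 → ℝ) : Matrix (Fin (n + 1)) (Fin (n + 1)) ℂ :=
  NormedSpace.exp ((-I) •∑ α : Fin 3, (θ α : ℂ) • spinVec n α)

/-! ### API -/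

/-- Entries of `Sᶻ`: `⟨k| Sᶻ |l⟩ = δ_{kl} (n/2 - k)`. Tasaki (2020) §2.1, eq. (2.1.5). [cite: Tasaki2020] -/
lemma spinZ_apply (k l : Fin (n + 1)) :
    SpinOperators.spinZ n k l = if k = l then (n : ℂ) / 2 - (k : ℂ) else 0 := by
  simp [SpinOperators.spinZ, diagonal_apply]

/-- Entries of `S⁺`: `⟨k| S⁺ |l⟩ = √((k+1)(n-k))` if `l = k+1` and `0` otherwise.
Tasaki (2020) §2.1, eq. (2.1.6). [cite: Tasaki2020] -/
lemma spinRaise_apply (k l : Fin (n + 1)) :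
    spinRaise n k l =
      if l.val = k.val + 1 then (Real.sqrt ((k.val + 1 : ℝ) * (n - k.val : ℝ)) : ℂ) else 0 :=
  rfl

/-- `S⁻` is the conjugate transpose of `S⁺`. Tasaki (2020) §2.1, eq. (2.1.6). [cite: Tasaki2020] -/
lemma spinLower_eq_conjTranspose : spinLower n = (spinRaise n)ᴴ := rfl

/-- Each spin component `S^α` is Hermitian (self-adjoint). Tasaki (2020) §2.1. [cite: Tasaki2020] -/
theorem spinVec_isHermitian (α : Fin 3) : (spinVec n α).IsHermitian := by
  fin_cases α
  · -- Sˣ = (S⁺ + (S⁺)ᴴ)/2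
    simp only [spinVec, Fin.zero_eta, cons_val_zero, spinX, spinLower, IsHermitian,
      conjTranspose_smul, conjTranspose_add, conjTranspose_conjTranspose]
    rw [add_comm ((spinRaise n)ᴴ)]
    congr 1
    simp
  · -- Sʸ = (S⁺ - (S⁺)ᴴ)/(2i)
    simp only [spinVec, Fin.mk_one, cons_val_one, cons_val_zero, spinY, spinLower, IsHermitian,
      conjTranspose_smul, conjTranspose_sub, conjTranspose_conjTranspose]
    rw [← neg_sub (spinRaise n), smul_neg, ← neg_smul]
    congr 1
    have h : star (1 / (2 * I) : ℂ) = 1 / (2 * -I) := by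
      rw [one_div, one_div, star_inv₀, star_mul, Complex.star_def, conj_I, map_ofNat, mul_comm]
    rw [h]
    ring
  · -- Sᶻ is real diagonal
    simp only [spinVec, Fin.reduceFinMk, cons_val_two, Nat.succ_eq_add_one, Nat.reduceAdd, SpinOperators.spinZ]
    refine isHermitian_diagonal_iff.mpr fun k => ?_
    rw [isSelfAdjoint_iff, Complex.star_def, map_sub, map_div₀, map_natCast, map_natCast,
      map_ofNat]

/-- **Spin commutation relations** `[Sᵃ, Sᵇ] = i ε_{abc} Sᶜ`, in the equivalent cyclic form
`[S^a, S^{a+1}] = i S^{a+2}` (indices mod `3`): `[Sˣ, Sʸ] = i Sᶻ`, `[Sʸ, Sᶻ] = i Sˣ`,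
`[Sᶻ, Sˣ] = i Sʸ`. Tasaki (2020) §2.1, eq. (2.1.1). [cite: Tasaki2020] -/
def spin_commutation : Prop :=
  ∀ (a : Fin 3),
    ⁅spinVec n a, spinVec n (a + 1)⁆ = I • spinVec n (a + 2)

/-- **Casimir eigenvalue**: `𝐒² = S(S+1) 𝟙` with `S = n/2`. Tasaki (2020) §2.1, eq. (2.1.2). [cite: Tasaki2020] -/
def spinCasimir_eq : Prop :=
  spinCasimir n = ((n : ℂ) / 2 * ((n : ℂ) / 2 + 1)) • (1 : Matrix (Fin (n + 1)) (Fin (n + 1)) ℂ)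

/-- For spin `1/2` (`n = 1`) the spin operators are half the Pauli matrices: `S^α = σ^α / 2`.
Tasaki (2020) §2.1, eq. (2.1.8). [cite: Tasaki2020] -/
theorem spinVec_one_eq_half_spinHalfPauli (α : Fin 3) :
    spinVec 1 α = (1 / 2 : ℂ) • spinHalfPauli α := by
  fin_cases α
  · ext i j
    fin_cases i <;> fin_cases j <;>
      simp [spinX, spinLower, spinRaise, spinHalfPauli, conjTranspose_apply]
  · ext i j
    fin_cases i <;> fin_cases j <;>
      simp [spinY, spinLower, spinRaise, spinHalfPauli, conjTranspose_apply, div_eq_mul_inv,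
        mul_comm]
  · ext i j
    fin_cases i <;> fin_cases j <;> norm_num [spinVec, SpinOperators.spinZ, spinHalfPauli]

/-- The spin rotation `exp(-i θ·𝐒)` is unitary (since `θ·𝐒` is Hermitian).
Tasaki (2020) §2.1, eq. (2.1.10). [cite: Tasaki2020] -/
def spinRotation_mem_unitaryGroup : Prop :=
  ∀ (θ : Fin 3 → ℝ),
    spinRotation n θ ∈ Matrix.unitaryGroup (Fin (n + 1)) ℂ

end QLattice

end Literature.MathematicalPhysics.QuantumLattice
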